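import Summits.MatrixMultiplication.MatrixMultiplication.Theorems.SaturationLadderTwinRestriction
import Summits.MatrixMultiplication.MatrixMultiplication.Theorems.SaturationLadderTwinDiagonalSix
import Literature.Computability.AlgebraicComplexity.RectangularExponentSubadditivity
import Literature.Computability.AlgebraicComplexity.RectangularExponentSymmetry
import HarnessLib

/-!
# SaturationLadder — twin rung: the EXACT twin certificate `ω(1, t, r) = 1 + r`

Route `SaturationLadder` (sub-problem `MatrixMultiplication`), support for the aside
`TwinSaturation` (stmt-MatrixMultiplication-30539).  The level-1 laser method on the twin
Coppersmith–Winograd tensor `TW_b`, `b = 2^j`, `d = 2^{j+1} + 3` (tensor layer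
`Theorems/SaturationLadderTwinRestriction.lean`, combinatorial layer
`Theorems/SaturationLadderTwinDiagonalSix.lean`), pushed to its sharp form.

* `omegaRect_tw_le_of_count₆` — six-letter count form: for counts `n₁, …, n₆` of the letters
  `(1,1,0), (0,1,1), (1,0,1), (0,2,0), (2,0,0), (0,0,2)` (`N = Σ nᵢ ≥ 1`) and a real `e` with
  `(2^{j+1}+3)^N · (N+1)^63 · 192 · exp(4 √(log 6 + N log 27)) ≤ 2^{N · min(H X, H Y, H Z) + e}` one has
  `ω(j n₁, (j+1) n₂ + n₁ + n₄, (j+1) n₃ + n₅) ≤ e`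
  (`X = (n₂+n₄+n₆, n₁+n₃, n₅)/N`, `Y = (n₃+n₅+n₆, n₁+n₂, n₄)/N`, `Z = (n₁+n₄+n₅, n₂+n₃, n₆)/N`).
* `junk_le_two_rpow` — the polynomial · stretched-exponential junk factor is `2^{o(M)}` along the
  dilations `N ↦ M N`: for every `ε > 0` some `M ≥ 1` has `J(M N) ≤ 2^{ε M}`.
* `two_rpow_entropyZ` — at an OUTPUT-PERFECT type (`n₁ + n₄ + n₅ = 2 n₆`, `n₂ + n₃ = 2^{j+1} n₆`, so
  `N = d n₆` and `Z = (2, 2^{j+1}, 1)/d`) the `Z`-entropy accounts exactly for the formats: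
  `2^{N · H(Z) + e₀} = d^N` with `e₀ = (j+1) n₂ + n₁ + n₄ + (j+1) n₃ + n₅`.
* **`omegaRect_tw_exact`** — if moreover `H(Z) ≤ H(X)` and `H(Z) ≤ H(Y)`, then
  `ω(j n₁, (j+1) n₂ + n₁ + n₄, (j+1) n₃ + n₅) ≤ (j+1) n₂ + n₁ + n₄ + (j+1) n₃ + n₅`
  (dilate the type by `M`, let `M → ∞`: the junk is `2^{o(M)}`, `ω` is homogeneous), and
* **`omegaRect_one_tw_exact`** — the saturation reading (permutation invariance + homogeneity of `ω`):
  `ω(1, t, r) ≤ 1 + r` for `t = j n₁ / ((j+1) n₃ + n₅)`, `r = ((j+1) n₂ + n₁ + n₄) / ((j+1) n₃ + n₅)`.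

So every output-perfect six-letter type whose `X`- and `Y`-marginals have at least the entropy of its
`Z`-marginal is a point `(t, r)` of EXACT rectangular saturation `ω(1, t, r) = 1 + r` (the lower
bound is the output size).  Numerically (cell `decomp-mm`, lens 1, gen 8, `exact_check.py` on the
item): `j = 5` gives `(t, r) ≈ (0.709, 31.5)`, `j = 8` gives `(0.811, 287)`, and along `j → ∞` the
best types have `(1 − t) log r → (5 log 5 − 7 log 2)/3 ≈ 1.065 < log 3`, which is what the rung
`TwinSaturation` (`r ≤ C · 3^{1/(1−t)}`) needs; the two entropy inequalities are all that is left to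
verify along a family, plus `omegaRect_mono'` between consecutive family members.

References: Coppersmith–Winograd 1990 §6–8 [CoppersmithWinograd1990]; Le Gall 2014 App. A
[LeGall2014]; ADVXXZ 2025, Thm. 3.2 and §3.4 [AlmanDuanVassilevskaWilliamsXuXuZhou2025];
Lotti–Romani 1983 [LottiRomani1983].  No new definitions, no named facts, no sorry.
-/

set_option linter.dupNamespace false
-- (single-conjunct summit: the namespace repeats `MatrixMultiplication`)

noncomputable section

open Finset
open scoped BigOperators

namespace Summit.MatrixMultiplication.MatrixMultiplication.Theorems.SaturationLadderTwinExact

open Literature.Computability.AlgebraicComplexity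
open Summit.MatrixMultiplication.MatrixMultiplication.Theorems.SaturationLadderTwinRestriction
  (omegaRect_tw_le_of_card)
open Summit.MatrixMultiplication.MatrixMultiplication.Theorems.SaturationLadderTwinDiagonalSix
  (twDiagonal)

/-! ## The six-letter count form -/

/-- **The level-1 twin laser method as one inequality (six letters).**
[cite: AlmanDuanVassilevskaWilliamsXuXuZhou2025, Thm. 3.2] [cite: LeGall2014, Appendix A.3] -/
theorem omegaRect_tw_le_of_count₆ (j n₁ n₂ n₃ n₄ n₅ n₆ : ℕ) (hN : 0 < n₁ + n₂ + n₃ + n₄ + n₅ + n₆)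
    (e : ℝ)
    (hcount : ((2 : ℝ) ^ (j + 1) + 3) ^ (n₁ + n₂ + n₃ + n₄ + n₅ + n₆) *
        ((((((n₁ + n₂ + n₃ + n₄ + n₅ + n₆ : ℕ)) : ℝ)) + 1) ^ 63 * 192 *
          Real.exp (4 * Real.sqrt (Real.log 6 +
            (((n₁ + n₂ + n₃ + n₄ + n₅ + n₆ : ℕ)) : ℝ) * Real.log 27))) ≤
      (2 : ℝ) ^ ((((n₁ + n₂ + n₃ + n₄ + n₅ + n₆ : ℕ)) : ℝ) *
          min (shannonEntropy ![((n₂ : ℝ) + n₄ + n₆) / (n₁ + n₂ + n₃ + n₄ + n₅ + n₆ : ℕ),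
              ((n₁ : ℝ) + n₃) / (n₁ + n₂ + n₃ + n₄ + n₅ + n₆ : ℕ),
              (n₅ : ℝ) / (n₁ + n₂ + n₃ + n₄ + n₅ + n₆ : ℕ)])
            (min (shannonEntropy ![((n₃ : ℝ) + n₅ + n₆) / (n₁ + n₂ + n₃ + n₄ + n₅ + n₆ : ℕ),
              ((n₁ : ℝ) + n₂) / (n₁ + n₂ + n₃ + n₄ + n₅ + n₆ : ℕ),
              (n₄ : ℝ) / (n₁ + n₂ + n₃ + n₄ + n₅ + n₆ : ℕ)])
              (shannonEntropy ![((n₁ : ℝ) + n₄ + n₅) / (n₁ + n₂ + n₃ + n₄ + n₅ + n₆ : ℕ),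
                ((n₂ : ℝ) + n₃) / (n₁ + n₂ + n₃ + n₄ + n₅ + n₆ : ℕ),
                (n₆ : ℝ) / (n₁ + n₂ + n₃ + n₄ + n₅ + n₆ : ℕ)])) + e)) :
    omegaRect ℂ ((j : ℝ) * n₁) (((j : ℝ) + 1) * n₂ + n₁ + n₄) (((j : ℝ) + 1) * n₃ + n₅) ≤ e := by
  obtain ⟨Δ, hS, hcnt, hfree, hsize⟩ := twDiagonal n₁ n₂ n₃ n₄ n₅ n₆ hN
  have hV : 1 ≤ Δ.card := by
    by_contra h0
    have h0' : Δ.card = 0 := by omega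
    rw [h0', Nat.cast_zero, zero_mul, zero_mul, zero_mul] at hsize
    exact absurd hsize (not_le.2 (by positivity))
  have hcard : ((2 : ℝ) ^ (j + 1) + 3) ^ (n₁ + n₂ + n₃ + n₄ + n₅ + n₆) ≤
      (Δ.card : ℝ) * (2 : ℝ) ^ e := by
    rw [Real.rpow_add (by norm_num : (0 : ℝ) < 2)] at hcount
    have hJ0 : (0 : ℝ) < ((((((n₁ + n₂ + n₃ + n₄ + n₅ + n₆ : ℕ)) : ℝ)) + 1) ^ 63 * 192 *
        Real.exp (4 * Real.sqrt (Real.log 6 +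
          (((n₁ + n₂ + n₃ + n₄ + n₅ + n₆ : ℕ)) : ℝ) * Real.log 27))) := by positivity
    have h2e : (0 : ℝ) ≤ (2 : ℝ) ^ e := by positivity
    nlinarith [hcount, hJ0, h2e, mul_le_mul_of_nonneg_right hsize h2e]
  exact omegaRect_tw_le_of_card j n₁ n₂ n₃ n₄ n₅ (n₁ + n₂ + n₃ + n₄ + n₅ + n₆) hN Δ hS hcnt hfree hV
    e hcard

/-! ## The junk factor is `2^{o(M)}` along dilations -/

/-- A crude bound for the junk factor: `(n+1)^63 · 192 · exp(4 √(log 6 + n log 27)) ≤ exp(404 √n)`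
for `n ≥ 1`. [folklore] -/
theorem junk_le_exp (n : ℕ) (hn : 1 ≤ n) :
    (((n : ℕ) : ℝ) + 1) ^ 63 * 192 * Real.exp (4 * Real.sqrt (Real.log 6 + (n : ℝ) * Real.log 27)) ≤
      Real.exp (404 * Real.sqrt n) := by
  have hn' : (1 : ℝ) ≤ n := by exact_mod_cast hn
  have hsq1 : (1 : ℝ) ≤ Real.sqrt n := by
    rw [show (1 : ℝ) = Real.sqrt 1 by simp]
    exact Real.sqrt_le_sqrt hn'
  -- `(n+1)^63 = exp (63 log (n+1)) ≤ exp (63 · 3 √n)`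
  have hlog : Real.log ((n : ℝ) + 1) ≤ 3 * Real.sqrt n := by
    -- `log x ≤ 2 √x` (the tree's `log_le_two_mul_sqrt`, inlined to keep the import cone small)
    have h1 : Real.log ((n : ℝ) + 1) ≤ 2 * Real.sqrt ((n : ℝ) + 1) := by
      have h0 : (0 : ℝ) < (n : ℝ) + 1 := by positivity
      have h := Real.log_le_sub_one_of_pos (Real.sqrt_pos.2 h0)
      rw [Real.log_sqrt h0.le] at h
      linarith [Real.sqrt_nonneg ((n : ℝ) + 1)]
    have h2 : Real.sqrt ((n : ℝ) + 1) ≤ Real.sqrt (2 * n) := Real.sqrt_le_sqrt (by linarith)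
    have h3 : Real.sqrt (2 * (n : ℝ)) = Real.sqrt 2 * Real.sqrt n :=
      Real.sqrt_mul (by norm_num) _
    have h4 : Real.sqrt 2 ≤ 3 / 2 := by
      rw [show (3 : ℝ) / 2 = Real.sqrt ((3 / 2) ^ 2) by rw [Real.sqrt_sq (by norm_num)]]
      exact Real.sqrt_le_sqrt (by norm_num)
    nlinarith [Real.sqrt_nonneg (n : ℝ)]
  have hpow : (((n : ℕ) : ℝ) + 1) ^ 63 ≤ Real.exp (189 * Real.sqrt n) := by
    have h0 : (0 : ℝ) < (n : ℝ) + 1 := by positivity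
    rw [← Real.exp_log (pow_pos h0 63), Real.exp_le_exp, Real.log_pow]
    push_cast
    linarith
  -- `192 ≤ exp 191`
  have h192 : (192 : ℝ) ≤ Real.exp (191 * Real.sqrt n) := by
    have h1 : Real.log 192 ≤ 192 - 1 := Real.log_le_sub_one_of_pos (by norm_num)
    have h2 : (192 : ℝ) = Real.exp (Real.log 192) := (Real.exp_log (by norm_num)).symm
    rw [h2, Real.exp_le_exp]
    nlinarith
  -- `4 √(log 6 + n log 27) ≤ 24 √n`
  have hsqrt : 4 * Real.sqrt (Real.log 6 + (n : ℝ) * Real.log 27) ≤ 24 * Real.sqrt n := by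
    have h6 : Real.log 6 ≤ 5 := by
      have := Real.log_le_sub_one_of_pos (show (0 : ℝ) < 6 by norm_num); linarith
    have h27 : Real.log 27 ≤ 26 := by
      have := Real.log_le_sub_one_of_pos (show (0 : ℝ) < 27 by norm_num); linarith
    have h1 : Real.log 6 + (n : ℝ) * Real.log 27 ≤ 36 * n := by nlinarith
    have h2 : Real.sqrt (Real.log 6 + (n : ℝ) * Real.log 27) ≤ Real.sqrt (36 * n) :=
      Real.sqrt_le_sqrt h1
    have h3 : Real.sqrt (36 * (n : ℝ)) = 6 * Real.sqrt n := by
      rw [Real.sqrt_mul (by norm_num), show (36 : ℝ) = 6 ^ 2 by norm_num,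
        Real.sqrt_sq (by norm_num)]
    linarith
  have hexp : Real.exp (4 * Real.sqrt (Real.log 6 + (n : ℝ) * Real.log 27)) ≤
      Real.exp (24 * Real.sqrt n) := Real.exp_le_exp.2 hsqrt
  calc (((n : ℕ) : ℝ) + 1) ^ 63 * 192 *
        Real.exp (4 * Real.sqrt (Real.log 6 + (n : ℝ) * Real.log 27))
      ≤ Real.exp (189 * Real.sqrt n) * Real.exp (191 * Real.sqrt n) *
          Real.exp (24 * Real.sqrt n) := by
        gcongr
    _ = Real.exp (404 * Real.sqrt n) := by
        rw [← Real.exp_add, ← Real.exp_add]; ring_nf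

/-- **The junk is `2^{o(M)}` along dilations**: for `N ≥ 1` and `ε > 0` there is `M ≥ 1` with
`(MN+1)^63 · 192 · exp(4 √(log 6 + MN log 27)) ≤ 2^{ε M}`. [folklore] -/
theorem junk_le_two_rpow (N : ℕ) (hN : 1 ≤ N) {ε : ℝ} (hε : 0 < ε) :
    ∃ M : ℕ, 1 ≤ M ∧
      ((((M * N : ℕ)) : ℝ) + 1) ^ 63 * 192 *
          Real.exp (4 * Real.sqrt (Real.log 6 + (((M * N : ℕ)) : ℝ) * Real.log 27)) ≤
        (2 : ℝ) ^ (ε * M) := by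
  -- choose `M ≥ (808 √N / ε)²`, `M ≥ 1`
  obtain ⟨M, hM⟩ := exists_nat_ge ((808 * Real.sqrt N / ε) ^ 2 + 1)
  have hM1 : 1 ≤ M := by
    have : (1 : ℝ) ≤ M := by nlinarith [sq_nonneg (808 * Real.sqrt N / ε)]
    exact_mod_cast this
  refine ⟨M, hM1, ?_⟩
  have hMN : 1 ≤ M * N := Nat.one_le_iff_ne_zero.2 (Nat.mul_ne_zero (by omega) (by omega))
  refine (junk_le_exp (M * N) hMN).trans ?_
  rw [Real.rpow_def_of_pos (by norm_num : (0 : ℝ) < 2), Real.exp_le_exp]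
  -- `404 √(MN) ≤ log 2 · ε M`
  have hlog2 : (1 : ℝ) / 2 ≤ Real.log 2 := by
    have := Real.log_two_gt_d9; linarith
  have hM' : (808 * Real.sqrt N / ε) ^ 2 ≤ (M : ℝ) := by linarith
  have hsM : 808 * Real.sqrt N / ε ≤ Real.sqrt M := by
    rw [← Real.sqrt_sq (by positivity : (0 : ℝ) ≤ 808 * Real.sqrt N / ε)]
    exact Real.sqrt_le_sqrt hM'
  have hsM' : 808 * Real.sqrt N ≤ ε * Real.sqrt M := by
    have := (div_le_iff₀ hε).1 hsM; linarith
  have hsqMN : Real.sqrt (((M * N : ℕ)) : ℝ) = Real.sqrt M * Real.sqrt N := by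
    push_cast; exact Real.sqrt_mul (Nat.cast_nonneg _) _
  have hMM : Real.sqrt (M : ℝ) * Real.sqrt M = M := Real.mul_self_sqrt (Nat.cast_nonneg _)
  rw [hsqMN]
  have hsMnn : (0 : ℝ) ≤ Real.sqrt M := Real.sqrt_nonneg _
  -- 404 √M √N ≤ (1/2) ε M ≤ log 2 · (ε M)
  have h1 : 404 * (Real.sqrt M * Real.sqrt N) ≤ (1 / 2) * (ε * M) := by
    have := mul_le_mul_of_nonneg_left hsM' hsMnn
    nlinarith [hMM]
  have h2 : (1 / 2) * (ε * M) ≤ Real.log 2 * (ε * M) :=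
    mul_le_mul_of_nonneg_right hlog2 (by positivity)
  linarith

/-! ## The output-perfect `Z`-entropy accounts exactly for the formats -/

/-- At an output-perfect type (`n₁ + n₄ + n₅ = 2 n₆`, `n₂ + n₃ = 2^{j+1} n₆`, hence `N = d n₆`,
`d = 2^{j+1} + 3`, `Z = (2, 2^{j+1}, 1)/d`): `2^{N · H(Z) + e₀} = d^N` with
`e₀ = (j+1) n₂ + n₁ + n₄ + (j+1) n₃ + n₅` (`H(Z) = log₂ d − (2 + (j+1) 2^{j+1})/d`). [folklore] -/
theorem two_rpow_entropyZ (j n₁ n₂ n₃ n₄ n₅ n₆ : ℕ) (hn₆ : 0 < n₆) (hz₁ : n₁ + n₄ + n₅ = 2 * n₆)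
    (hz₂ : n₂ + n₃ = 2 ^ (j + 1) * n₆) :
    (2 : ℝ) ^ ((((n₁ + n₂ + n₃ + n₄ + n₅ + n₆ : ℕ)) : ℝ) *
        shannonEntropy ![((n₁ : ℝ) + n₄ + n₅) / (n₁ + n₂ + n₃ + n₄ + n₅ + n₆ : ℕ),
          ((n₂ : ℝ) + n₃) / (n₁ + n₂ + n₃ + n₄ + n₅ + n₆ : ℕ),
          (n₆ : ℝ) / (n₁ + n₂ + n₃ + n₄ + n₅ + n₆ : ℕ)] +
        ((((j : ℝ) + 1) * n₂ + n₁ + n₄) + (((j : ℝ) + 1) * n₃ + n₅))) =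
      (((2 : ℝ) ^ (j + 1) + 3)) ^ (n₁ + n₂ + n₃ + n₄ + n₅ + n₆) := by
  -- abbreviations: `B = 2^{j+1}`, `d = B + 3`, `N = d n₆`
  have hz₁' : (n₁ : ℝ) + n₄ + n₅ = 2 * n₆ := by exact_mod_cast hz₁
  have hz₂' : (n₂ : ℝ) + n₃ = (2 : ℝ) ^ (j + 1) * n₆ := by exact_mod_cast hz₂
  have hNd : (((n₁ + n₂ + n₃ + n₄ + n₅ + n₆ : ℕ)) : ℝ) = ((2 : ℝ) ^ (j + 1) + 3) * n₆ := by
    push_cast; linarith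
  have hn₆' : (0 : ℝ) < n₆ := by exact_mod_cast hn₆
  have hB : (0 : ℝ) < (2 : ℝ) ^ (j + 1) := by positivity
  have hd : (0 : ℝ) < (2 : ℝ) ^ (j + 1) + 3 := by positivity
  set d : ℝ := (2 : ℝ) ^ (j + 1) + 3 with hd_def
  -- the three entries of `Z`
  have eZ₀ : ((n₁ : ℝ) + n₄ + n₅) / (n₁ + n₂ + n₃ + n₄ + n₅ + n₆ : ℕ) = 2 / d := by
    rw [hNd, hz₁']; field_simp
  have eZ₁ : ((n₂ : ℝ) + n₃) / (n₁ + n₂ + n₃ + n₄ + n₅ + n₆ : ℕ) = (2 : ℝ) ^ (j + 1) / d := by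
    rw [hNd, hz₂']; field_simp
  have eZ₂ : (n₆ : ℝ) / (n₁ + n₂ + n₃ + n₄ + n₅ + n₆ : ℕ) = 1 / d := by
    rw [hNd]; field_simp
  rw [eZ₀, eZ₁, eZ₂, hNd]
  -- `H(Z) · log 2 = log d − (2 log 2 + B (j+1) log 2)/d`
  have hH : shannonEntropy ![2 / d, (2 : ℝ) ^ (j + 1) / d, 1 / d] * Real.log 2 =
      Real.log d - (2 * Real.log 2 + (2 : ℝ) ^ (j + 1) * (((j : ℝ) + 1) * Real.log 2)) / d := by
    rw [shannonEntropy_def, div_mul_cancel₀ _ (Real.log_pos one_lt_two).ne']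
    simp only [Fin.sum_univ_three, Matrix.cons_val_zero, Matrix.cons_val_one, Matrix.cons_val_two,
      Matrix.head_cons, Matrix.tail_cons, Real.negMulLog, Real.log_div two_ne_zero hd.ne',
      Real.log_div hB.ne' hd.ne', Real.log_div one_ne_zero hd.ne', Real.log_one, Real.log_pow]
    have : d = (2 : ℝ) ^ (j + 1) + 3 := hd_def
    field_simp
    push_cast
    ring
  have hlog2 : (0 : ℝ) < Real.log 2 := Real.log_pos one_lt_two
  -- compare logarithms
  have hdN : (0 : ℝ) < d ^ (n₁ + n₂ + n₃ + n₄ + n₅ + n₆) := pow_pos hd _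
  rw [← Real.exp_log hdN, Real.rpow_def_of_pos (by norm_num : (0 : ℝ) < 2), Real.log_pow]
  congr 1
  have hNd' : (((n₁ + n₂ + n₃ + n₄ + n₅ + n₆ : ℕ)) : ℝ) = d * n₆ := hNd
  rw [hNd']
  have key : d * (n₆ : ℝ) * shannonEntropy ![2 / d, (2 : ℝ) ^ (j + 1) / d, 1 / d] * Real.log 2 =
      d * n₆ * Real.log d - n₆ * (2 * Real.log 2 + (2 : ℝ) ^ (j + 1) * (((j : ℝ) + 1) * Real.log 2)) := by
    rw [mul_assoc (d * (n₆ : ℝ)), hH]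
    field_simp
  have e₀ : (((j : ℝ) + 1) * n₂ + n₁ + n₄) + (((j : ℝ) + 1) * n₃ + n₅) =
      2 * n₆ + ((j : ℝ) + 1) * ((2 : ℝ) ^ (j + 1) * n₆) := by linear_combination hz₁' + ((j : ℝ) + 1) * hz₂'
  rw [e₀]
  nlinarith [key]

/-! ## The exact certificate -/

/-- **Exact twin certificate.**  At an output-perfect six-letter type whose `X`- and `Y`-marginals
have at least the entropy of its `Z`-marginal,
`ω(j n₁, (j+1) n₂ + n₁ + n₄, (j+1) n₃ + n₅) ≤ (j+1) n₂ + n₁ + n₄ + (j+1) n₃ + n₅`.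
[cite: CoppersmithWinograd1990, §8] [cite: AlmanDuanVassilevskaWilliamsXuXuZhou2025, Thm. 3.2] -/
theorem omegaRect_tw_exact (j n₁ n₂ n₃ n₄ n₅ n₆ : ℕ) (hn₆ : 0 < n₆) (hz₁ : n₁ + n₄ + n₅ = 2 * n₆)
    (hz₂ : n₂ + n₃ = 2 ^ (j + 1) * n₆)
    (hX : shannonEntropy ![((n₁ : ℝ) + n₄ + n₅) / (n₁ + n₂ + n₃ + n₄ + n₅ + n₆ : ℕ),
          ((n₂ : ℝ) + n₃) / (n₁ + n₂ + n₃ + n₄ + n₅ + n₆ : ℕ),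
          (n₆ : ℝ) / (n₁ + n₂ + n₃ + n₄ + n₅ + n₆ : ℕ)] ≤
        shannonEntropy ![((n₂ : ℝ) + n₄ + n₆) / (n₁ + n₂ + n₃ + n₄ + n₅ + n₆ : ℕ),
          ((n₁ : ℝ) + n₃) / (n₁ + n₂ + n₃ + n₄ + n₅ + n₆ : ℕ),
          (n₅ : ℝ) / (n₁ + n₂ + n₃ + n₄ + n₅ + n₆ : ℕ)])
    (hY : shannonEntropy ![((n₁ : ℝ) + n₄ + n₅) / (n₁ + n₂ + n₃ + n₄ + n₅ + n₆ : ℕ),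
          ((n₂ : ℝ) + n₃) / (n₁ + n₂ + n₃ + n₄ + n₅ + n₆ : ℕ),
          (n₆ : ℝ) / (n₁ + n₂ + n₃ + n₄ + n₅ + n₆ : ℕ)] ≤
        shannonEntropy ![((n₃ : ℝ) + n₅ + n₆) / (n₁ + n₂ + n₃ + n₄ + n₅ + n₆ : ℕ),
          ((n₁ : ℝ) + n₂) / (n₁ + n₂ + n₃ + n₄ + n₅ + n₆ : ℕ),
          (n₄ : ℝ) / (n₁ + n₂ + n₃ + n₄ + n₅ + n₆ : ℕ)]) :
    omegaRect ℂ ((j : ℝ) * n₁) (((j : ℝ) + 1) * n₂ + n₁ + n₄) (((j : ℝ) + 1) * n₃ + n₅) ≤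
      (((j : ℝ) + 1) * n₂ + n₁ + n₄) + (((j : ℝ) + 1) * n₃ + n₅) := by
  set N : ℕ := n₁ + n₂ + n₃ + n₄ + n₅ + n₆ with hNdef
  have hN1 : 1 ≤ N := by omega
  set x₀ : ℝ := (j : ℝ) * n₁ with hx₀
  set y₀ : ℝ := ((j : ℝ) + 1) * n₂ + n₁ + n₄ with hy₀
  set z₀ : ℝ := ((j : ℝ) + 1) * n₃ + n₅ with hz₀
  set HZ : ℝ := shannonEntropy ![((n₁ : ℝ) + n₄ + n₅) / N, ((n₂ : ℝ) + n₃) / N, (n₆ : ℝ) / N]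
    with hHZ
  refine le_of_forall_pos_le_add fun ε hε => ?_
  obtain ⟨M, hM1, hJ⟩ := junk_le_two_rpow N hN1 hε
  have hM0 : (0 : ℝ) < M := by exact_mod_cast hM1
  have hMN : 0 < M * n₁ + M * n₂ + M * n₃ + M * n₄ + M * n₅ + M * n₆ := by nlinarith
  -- the scaled type has the same marginal laws
  have hsum : M * n₁ + M * n₂ + M * n₃ + M * n₄ + M * n₅ + M * n₆ = M * N := by rw [hNdef]; ring
  have hNr : (0 : ℝ) < (N : ℝ) := by exact_mod_cast hN1
  have resc : ∀ p q r : ℝ,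
      ![((M : ℝ) * p) / ((M * N : ℕ) : ℝ), ((M : ℝ) * q) / ((M * N : ℕ) : ℝ),
        ((M : ℝ) * r) / ((M * N : ℕ) : ℝ)] = ![p / N, q / N, r / N] := by
    intro p q r
    have e : ∀ s : ℝ, ((M : ℝ) * s) / ((M * N : ℕ) : ℝ) = s / N := fun s => by
      push_cast; rw [mul_div_mul_left _ _ hM0.ne']
    rw [e, e, e]
  -- the count hypothesis for the scaled type, with `e = M (y₀ + z₀) + ε M`
  have hmain := omegaRect_tw_le_of_count₆ j (M * n₁) (M * n₂) (M * n₃) (M * n₄) (M * n₅) (M * n₆)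
    hMN ((M : ℝ) * (y₀ + z₀) + ε * M) ?_
  · -- homogeneity: the left side is `M · ω(x₀, y₀, z₀)`
    have hx : (0 : ℝ) ≤ x₀ := by positivity
    have hy : (0 : ℝ) ≤ y₀ := by positivity
    have hz : (0 : ℝ) ≤ z₀ := by positivity
    have hhom := LottiRomani1983_homogeneous ℂ hM0.le hx hy hz
    have e₁ : (j : ℝ) * ((M * n₁ : ℕ) : ℝ) = (M : ℝ) * x₀ := by push_cast; ring
    have e₂ : ((j : ℝ) + 1) * ((M * n₂ : ℕ) : ℝ) + ((M * n₁ : ℕ) : ℝ) + ((M * n₄ : ℕ) : ℝ) =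
        (M : ℝ) * y₀ := by push_cast; ring
    have e₃ : ((j : ℝ) + 1) * ((M * n₃ : ℕ) : ℝ) + ((M * n₅ : ℕ) : ℝ) = (M : ℝ) * z₀ := by
      push_cast; ring
    rw [e₁, e₂, e₃, hhom] at hmain
    have : omegaRect ℂ x₀ y₀ z₀ ≤ (y₀ + z₀) + ε := by
      have h := div_le_div_of_nonneg_right hmain hM0.le
      rw [mul_div_cancel_left₀ _ hM0.ne'] at h
      have e : ((M : ℝ) * (y₀ + z₀) + ε * M) / M = (y₀ + z₀) + ε := by field_simp
      rw [e] at h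
      exact h
    simpa [hy₀, hz₀] using this
  · -- the hypothesis: `d^{MN} · J(MN) ≤ 2^{MN · Hmin + M(y₀+z₀) + εM}` with `Hmin = H(Z)`
    rw [hsum]
    have vX := resc ((n₂ : ℝ) + n₄ + n₆) ((n₁ : ℝ) + n₃) (n₅ : ℝ)
    have vY := resc ((n₃ : ℝ) + n₅ + n₆) ((n₁ : ℝ) + n₂) (n₄ : ℝ)
    have vZ := resc ((n₁ : ℝ) + n₄ + n₅) ((n₂ : ℝ) + n₃) (n₆ : ℝ)
    have cX : ![(((M * n₂ : ℕ) : ℝ) + ((M * n₄ : ℕ) : ℝ) + ((M * n₆ : ℕ) : ℝ)) / ((M * N : ℕ) : ℝ),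
        (((M * n₁ : ℕ) : ℝ) + ((M * n₃ : ℕ) : ℝ)) / ((M * N : ℕ) : ℝ),
        ((M * n₅ : ℕ) : ℝ) / ((M * N : ℕ) : ℝ)] =
        ![((n₂ : ℝ) + n₄ + n₆) / N, ((n₁ : ℝ) + n₃) / N, (n₅ : ℝ) / N] := by
      rw [← vX]; push_cast; ring_nf
    have cY : ![(((M * n₃ : ℕ) : ℝ) + ((M * n₅ : ℕ) : ℝ) + ((M * n₆ : ℕ) : ℝ)) / ((M * N : ℕ) : ℝ),
        (((M * n₁ : ℕ) : ℝ) + ((M * n₂ : ℕ) : ℝ)) / ((M * N : ℕ) : ℝ),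
        ((M * n₄ : ℕ) : ℝ) / ((M * N : ℕ) : ℝ)] =
        ![((n₃ : ℝ) + n₅ + n₆) / N, ((n₁ : ℝ) + n₂) / N, (n₄ : ℝ) / N] := by
      rw [← vY]; push_cast; ring_nf
    have cZ : ![(((M * n₁ : ℕ) : ℝ) + ((M * n₄ : ℕ) : ℝ) + ((M * n₅ : ℕ) : ℝ)) / ((M * N : ℕ) : ℝ),
        (((M * n₂ : ℕ) : ℝ) + ((M * n₃ : ℕ) : ℝ)) / ((M * N : ℕ) : ℝ),
        ((M * n₆ : ℕ) : ℝ) / ((M * N : ℕ) : ℝ)] =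
        ![((n₁ : ℝ) + n₄ + n₅) / N, ((n₂ : ℝ) + n₃) / N, (n₆ : ℝ) / N] := by
      rw [← vZ]; push_cast; ring_nf
    rw [cX, cY, cZ, min_eq_right hY, min_eq_right hX]
    -- `2^{MN · HZ + M(y₀+z₀)} = (2^{N HZ + (y₀+z₀)})^M = d^{NM}`
    have hZpow := two_rpow_entropyZ j n₁ n₂ n₃ n₄ n₅ n₆ hn₆ hz₁ hz₂
    rw [← hNdef] at hZpow
    have h2 : (0 : ℝ) < 2 := by norm_num
    have split : (2 : ℝ) ^ (((M * N : ℕ) : ℝ) * HZ + ((M : ℝ) * (y₀ + z₀) + ε * M)) =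
        ((2 : ℝ) ^ ((N : ℝ) * HZ + (y₀ + z₀))) ^ M * (2 : ℝ) ^ (ε * M) := by
      rw [← Real.rpow_natCast ((2 : ℝ) ^ ((N : ℝ) * HZ + (y₀ + z₀))) M, ← Real.rpow_mul h2.le,
        ← Real.rpow_add h2]
      congr 1; push_cast; ring
    rw [split, hHZ, hy₀, hz₀, hZpow, ← pow_mul, mul_comm N M]
    exact mul_le_mul_of_nonneg_left hJ (pow_nonneg (by positivity) _)

/-- **Exact rectangular saturation from the twin tensor.**  Under the hypotheses of
`omegaRect_tw_exact` and `(j+1) n₃ + n₅ ≥ 1`:  `ω(1, t, r) ≤ 1 + r` for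
`t = j n₁ / ((j+1) n₃ + n₅)` and `r = ((j+1) n₂ + n₁ + n₄) / ((j+1) n₃ + n₅)` — equality holds, the
right side being the output size (permutation invariance `ω(x,y,z) = ω(z,x,y)` and homogeneity).
[cite: AlmanDuanVassilevskaWilliamsXuXuZhou2025, §3.4] [cite: LottiRomani1983, §1 (p. 173)] -/
theorem omegaRect_one_tw_exact (j n₁ n₂ n₃ n₄ n₅ n₆ : ℕ) (hn₆ : 0 < n₆)
    (hz₁ : n₁ + n₄ + n₅ = 2 * n₆) (hz₂ : n₂ + n₃ = 2 ^ (j + 1) * n₆) (hz₀ : 0 < (j + 1) * n₃ + n₅)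
    (hX : shannonEntropy ![((n₁ : ℝ) + n₄ + n₅) / (n₁ + n₂ + n₃ + n₄ + n₅ + n₆ : ℕ),
          ((n₂ : ℝ) + n₃) / (n₁ + n₂ + n₃ + n₄ + n₅ + n₆ : ℕ),
          (n₆ : ℝ) / (n₁ + n₂ + n₃ + n₄ + n₅ + n₆ : ℕ)] ≤
        shannonEntropy ![((n₂ : ℝ) + n₄ + n₆) / (n₁ + n₂ + n₃ + n₄ + n₅ + n₆ : ℕ),
          ((n₁ : ℝ) + n₃) / (n₁ + n₂ + n₃ + n₄ + n₅ + n₆ : ℕ),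
          (n₅ : ℝ) / (n₁ + n₂ + n₃ + n₄ + n₅ + n₆ : ℕ)])
    (hY : shannonEntropy ![((n₁ : ℝ) + n₄ + n₅) / (n₁ + n₂ + n₃ + n₄ + n₅ + n₆ : ℕ),
          ((n₂ : ℝ) + n₃) / (n₁ + n₂ + n₃ + n₄ + n₅ + n₆ : ℕ),
          (n₆ : ℝ) / (n₁ + n₂ + n₃ + n₄ + n₅ + n₆ : ℕ)] ≤
        shannonEntropy ![((n₃ : ℝ) + n₅ + n₆) / (n₁ + n₂ + n₃ + n₄ + n₅ + n₆ : ℕ),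
          ((n₁ : ℝ) + n₂) / (n₁ + n₂ + n₃ + n₄ + n₅ + n₆ : ℕ),
          (n₄ : ℝ) / (n₁ + n₂ + n₃ + n₄ + n₅ + n₆ : ℕ)]) :
    omegaRect ℂ 1 (((j : ℝ) * n₁) / (((j : ℝ) + 1) * n₃ + n₅))
        ((((j : ℝ) + 1) * n₂ + n₁ + n₄) / (((j : ℝ) + 1) * n₃ + n₅)) ≤
      1 + (((j : ℝ) + 1) * n₂ + n₁ + n₄) / (((j : ℝ) + 1) * n₃ + n₅) := by
  have h := omegaRect_tw_exact j n₁ n₂ n₃ n₄ n₅ n₆ hn₆ hz₁ hz₂ hX hY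
  set x₀ : ℝ := (j : ℝ) * n₁
  set y₀ : ℝ := ((j : ℝ) + 1) * n₂ + n₁ + n₄
  set z₀ : ℝ := ((j : ℝ) + 1) * n₃ + n₅ with hz₀def
  have hzpos : (0 : ℝ) < z₀ := by
    have h0 : (0 : ℝ) < (((j + 1) * n₃ + n₅ : ℕ) : ℝ) := by exact_mod_cast hz₀
    rw [hz₀def]; push_cast at h0; linarith
  -- `ω(x₀, y₀, z₀) = ω(z₀, x₀, y₀) = z₀ · ω(1, x₀/z₀, y₀/z₀)`
  rw [← omegaRect_rotate ℂ z₀ x₀ y₀] at h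
  have hhom := LottiRomani1983_homogeneous ℂ hzpos.le zero_le_one
    (by positivity : (0 : ℝ) ≤ x₀ / z₀) (by positivity : (0 : ℝ) ≤ y₀ / z₀)
  rw [mul_one, mul_div_cancel₀ _ hzpos.ne', mul_div_cancel₀ _ hzpos.ne'] at hhom
  rw [hhom] at h
  have h' : omegaRect ℂ 1 (x₀ / z₀) (y₀ / z₀) ≤ (y₀ + z₀) / z₀ := by
    rw [le_div_iff₀ hzpos]; linarith
  have e : (y₀ + z₀) / z₀ = 1 + y₀ / z₀ := by field_simp; ring
  rw [e] at h'
  exact h'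

end Summit.MatrixMultiplication.MatrixMultiplication.Theorems.SaturationLadderTwinExact

end
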